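import Summits.Parity.BatemanHorn.Theorems.SoloInformedTwinUnbalancedSmall

/-!
# SoloInformedMoebiusBVInput — the Bombieri–Vinogradov input of regime (1a), from the base theorem

Solo unit `solo-Parity-informed` (ideation tier, informed mode), session 80; PLAN §60/§63 (file F3 of
the kernel project F1–F5), CLAIMS C144/C150.

`SoloInformedTwinUnbalancedSmall.sum_abs_innerP_small_le_of_bv` takes the Bombieri–Vinogradov
theorem for `μ` without main term over dilated moduli as the hypothesis `MoebiusBVDilate A'` — by
definition the statement of the tree theorem
`Literature.NumberTheory.Sieve.BVMoebius.sum_abs_moebiusAPSum_dilate_le`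
(`Literature/NumberTheory/Sieve/BombieriVinogradovMoebiusIntervals.lean`, PROVED).  That module is a
leaf of the Literature library whose compiled form is not available to this file's build, so this
file re-derives `MoebiusBVDilate A` (inside ONE theorem, no new mathematics and no new claim) from
the BUILT base theorem `Literature.NumberTheory.Sieve.bombieriVinogradov_moebius`
(Iwaniec–Kowalski Thm 17.4 for `μ`, with the subtracted coprime mean), exactly along the tree's
proofs of `BVMoebius.abs_moebiusCoprimeSum_le_uniform` (the coprime mean is
`≪ 4^{ω(q)} x (log x)^{-A-8}` by `Polymath8a.sum_moebius_coprime_progression_le_uniform` at modulus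
`1` fed with `LFunctions.SiegelWalfiszMoebius_holds`), `BVMoebius.sum_abs_moebiusAPSum_le`
(summing `4^{ω(q)}/φ(q)` with `BVMoebius.sum_four_pow_div_totient_le`) and
`BVMoebius.sum_abs_moebiusAPSum_dilate_le` (re-indexing the dilated moduli `k d ↦ q`).
Consequence: regime (1a) of (F′), `sum_abs_innerP_small_le_base`, with no hypothesis.
-/

namespace Summit.Parity.BatemanHorn.Theorems

open Finset Real ArithmeticFunction
open scoped ArithmeticFunction.Moebius ArithmeticFunction.omega
open Literature.NumberTheory Literature.NumberTheory.Sieve Literature.NumberTheory.Sieve.BVMoebius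

set_option maxHeartbeats 800000 in
/-- `MoebiusBVDilate A` for every `A > 0` — Bombieri–Vinogradov for `μ` without main term over
dilated moduli (the statement of `BVMoebius.sum_abs_moebiusAPSum_dilate_le A`), derived here from
the base theorem `bombieriVinogradov_moebius` as in the tree file
`BombieriVinogradovMoebiusIntervals.lean`. -/
theorem moebiusBVDilate_of_base (A : ℝ) (hA : 0 < A) : MoebiusBVDilate A := by
  classical
  -- (1) the coprime mean: `|∑_{n ≤ N, (n,q)=1} μ(n)| ≤ C₂ 4^{ω(q)} x (log x)^{-(A+8)}`, `N ≤ x`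
  have hSW : ∃ C : ℝ, 0 ≤ C ∧ ∀ x : ℝ, 3 ≤ x → ∀ q : ℕ, 1 ≤ q → ∀ N : ℕ, (N : ℝ) ≤ x →
      |moebiusCoprimeSum N q| ≤ C * (4 : ℝ) ^ q.primeFactors.card * x / Real.log x ^ (A + 8) := by
    obtain ⟨C, hC0, hC⟩ := Polymath8a.sum_moebius_coprime_progression_le_uniform
      LFunctions.SiegelWalfiszMoebius_holds (A := 1) one_pos (B := A + 8) (by positivity)
    refine ⟨C, hC0, fun x hx q hq N hN => ?_⟩
    rcases Nat.eq_zero_or_pos N with rfl | hNpos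
    · have : moebiusCoprimeSum 0 q = 0 := by
        rw [moebiusCoprimeSum, show Icc 1 0 = (∅ : Finset ℕ) by rfl, Finset.filter_empty,
          sum_empty]
      rw [this, abs_zero]
      have hlog : 0 < Real.log x := Real.log_pos (by linarith)
      positivity
    have hlog1 : (1 : ℝ) ≤ Real.log x := by
      rw [Real.le_log_iff_exp_le (by linarith)]
      have := Real.exp_one_lt_d9
      linarith
    have hk : ((1 : ℕ) : ℝ) ≤ Real.log x ^ (1 : ℝ) := by
      rw [Real.rpow_one]; exact_mod_cast hlog1
    have hu : IsUnit (0 : ZMod 1) := isUnit_of_subsingleton _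
    have h := hC x (by linarith) 1 le_rfl hk 0 hu q (by omega) N (by exact_mod_cast hNpos) hN
    rw [Nat.floor_natCast] at h
    have hfilter : (Icc 1 N).filter (fun n : ℕ => (n : ZMod 1) = 0 ∧ n.Coprime q) =
        (Icc 1 N).filter (fun n : ℕ => n.Coprime q) := by
      refine Finset.filter_congr fun n _ => ?_
      simp only [and_iff_right_iff_imp]
      exact fun _ => Subsingleton.elim _ _
    rw [hfilter] at h
    exact h
  -- (2) Bombieri–Vinogradov without main term, undilated
  have hND : ∃ B C x₀ : ℝ, 0 < B ∧ 0 ≤ C ∧ ∀ x : ℝ, x₀ ≤ x →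
      ∀ Q : ℕ, (Q : ℝ) ≤ x ^ (1 / 2 : ℝ) / Real.log x ^ B →
      ∀ N : ℕ → ℕ, (∀ q, (N q : ℝ) ≤ x) →
      ∀ a : (q : ℕ) → ZMod q, (∀ q ∈ Icc 1 Q, IsUnit (a q)) →
        ∑ q ∈ Icc 1 Q, |moebiusAPSum (N q) q (a q)| ≤ C * x / Real.log x ^ A := by
    obtain ⟨B, C₁, x₀, hB, hC₁, hBV⟩ := bombieriVinogradov_moebius A hA
    obtain ⟨C₂, hC₂0, hSW⟩ := hSW
    refine ⟨B, C₁ + C₂, max x₀ 9, hB, by positivity, ?_⟩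
    intro x hx Q hQ N hN a ha
    have hx₀ : x₀ ≤ x := le_trans (le_max_left _ _) hx
    have hx9 : (9 : ℝ) ≤ x := le_trans (le_max_right _ _) hx
    have hx0 : 0 < x := by linarith
    have hL2 : 2 ≤ Real.log x := two_le_log_of_nine_le hx9
    have hL0 : 0 < Real.log x := by linarith
    have hL1 : 1 ≤ Real.log x := by linarith
    have hQs : (Q : ℝ) ≤ x ^ (1 / 2 : ℝ) :=
      hQ.trans (div_le_self (by positivity) (Real.one_le_rpow hL1 hB.le))
    have hlogQ : 1 + Real.log Q ≤ Real.log x := by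
      rcases Nat.eq_zero_or_pos Q with rfl | hQ0
      · simp; linarith
      · have hQ1 : (0 : ℝ) < Q := by exact_mod_cast hQ0
        have h1 : Real.log Q ≤ Real.log (x ^ (1 / 2 : ℝ)) := Real.log_le_log hQ1 hQs
        rw [Real.log_rpow hx0] at h1
        linarith
    have hlogQ0 : 0 ≤ 1 + Real.log Q := by
      have : 0 ≤ Real.log (Q : ℝ) := Real.log_natCast_nonneg Q; linarith
    have hsplit : ∀ q, |moebiusAPSum (N q) q (a q)| ≤
        |moebiusDisc (N q) q (a q)| + ((Nat.totient q : ℝ))⁻¹ * |moebiusCoprimeSum (N q) q| := by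
      intro q
      have hφ : (0 : ℝ) ≤ ((Nat.totient q : ℝ))⁻¹ := inv_nonneg.2 (Nat.cast_nonneg _)
      have e : moebiusAPSum (N q) q (a q) =
          moebiusDisc (N q) q (a q) + ((Nat.totient q : ℝ))⁻¹ * moebiusCoprimeSum (N q) q := by
        rw [moebiusDisc]; ring
      rw [e]
      refine (abs_add_le _ _).trans ?_
      rw [abs_mul, abs_of_nonneg hφ]
    have h1 : ∑ q ∈ Icc 1 Q, |moebiusDisc (N q) q (a q)| ≤ C₁ * x / Real.log x ^ A :=
      hBV x hx₀ Q hQ N hN a ha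
    have h2 : ∑ q ∈ Icc 1 Q, ((Nat.totient q : ℝ))⁻¹ * |moebiusCoprimeSum (N q) q| ≤
        C₂ * x / Real.log x ^ A := by
      have hLA8 : 0 < Real.log x ^ (A + 8) := Real.rpow_pos_of_pos hL0 _
      calc ∑ q ∈ Icc 1 Q, ((Nat.totient q : ℝ))⁻¹ * |moebiusCoprimeSum (N q) q|
          ≤ ∑ q ∈ Icc 1 Q, ((Nat.totient q : ℝ))⁻¹ *
              (C₂ * (4 : ℝ) ^ q.primeFactors.card * x / Real.log x ^ (A + 8)) := by
            refine sum_le_sum fun q hq => ?_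
            refine mul_le_mul_of_nonneg_left ?_ (inv_nonneg.2 (Nat.cast_nonneg _))
            exact hSW x (by linarith) q (mem_Icc.1 hq).1 (N q) (hN q)
        _ = C₂ * x / Real.log x ^ (A + 8) *
              ∑ q ∈ Icc 1 Q, (4 : ℝ) ^ q.primeFactors.card / Nat.totient q := by
            rw [mul_sum]
            refine sum_congr rfl fun q _ => ?_
            ring
        _ ≤ C₂ * x / Real.log x ^ (A + 8) * (1 + Real.log Q) ^ 8 := by
            refine mul_le_mul_of_nonneg_left (sum_four_pow_div_totient_le Q) ?_
            positivity
        _ ≤ C₂ * x / Real.log x ^ (A + 8) * Real.log x ^ 8 := by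
            refine mul_le_mul_of_nonneg_left (pow_le_pow_left₀ hlogQ0 hlogQ 8) ?_
            positivity
        _ = C₂ * x / Real.log x ^ A := by
            rw [Real.rpow_add hL0, show ((8 : ℝ)) = ((8 : ℕ) : ℝ) by norm_num, Real.rpow_natCast]
            have : 0 < Real.log x ^ A := Real.rpow_pos_of_pos hL0 _
            have : 0 < Real.log x ^ (8 : ℕ) := pow_pos hL0 _
            field_simp
    calc ∑ q ∈ Icc 1 Q, |moebiusAPSum (N q) q (a q)|
        ≤ ∑ q ∈ Icc 1 Q, (|moebiusDisc (N q) q (a q)| +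
            ((Nat.totient q : ℝ))⁻¹ * |moebiusCoprimeSum (N q) q|) := sum_le_sum fun q _ => hsplit q
      _ = _ := sum_add_distrib
      _ ≤ C₁ * x / Real.log x ^ A + C₂ * x / Real.log x ^ A := add_le_add h1 h2
      _ = (C₁ + C₂) * x / Real.log x ^ A := by ring
  -- (3) dilation `q = k d`
  obtain ⟨B, C, x₀, hB, hC, h⟩ := hND
  refine ⟨B, C, max x₀ 1, hB, hC, ?_⟩
  intro x hx k hk 𝒟 h𝒟 t ht a ha
  have hx₀ : x₀ ≤ x := le_trans (le_max_left _ _) hx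
  have hx1 : 1 ≤ x := le_trans (le_max_right _ _) hx
  have hlog : 0 ≤ Real.log x := Real.log_nonneg hx1
  have hlev0 : 0 ≤ x ^ (1 / 2 : ℝ) / Real.log x ^ B :=
    div_nonneg (Real.rpow_nonneg (by linarith) _) (Real.rpow_nonneg hlog _)
  set Q := ⌊x ^ (1 / 2 : ℝ) / Real.log x ^ B⌋₊ with hQdef
  have hQ : (Q : ℝ) ≤ x ^ (1 / 2 : ℝ) / Real.log x ^ B := Nat.floor_le hlev0
  set 𝓛 := 𝒟.image (fun d => k * d) with h𝓛def
  have h𝓛 : 𝓛 ⊆ Icc 1 Q := by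
    intro L hL
    obtain ⟨d, hd, rfl⟩ := mem_image.1 hL
    rw [mem_Icc]
    refine ⟨Nat.mul_pos hk (h𝒟 d hd).1, ?_⟩
    rw [Nat.le_floor_iff hlev0]
    exact (h𝒟 d hd).2
  set t' : ℕ → ℕ := fun L => t (L / k) with ht'def
  set a' : (q : ℕ) → ZMod q := fun L => if L ∈ 𝓛 then ((a (L / k) : ℕ) : ZMod L) else 1
    with ha'def
  have hsum : ∑ d ∈ 𝒟, |moebiusAPSum (t d) (k * d) ((a d : ℕ) : ZMod (k * d))| =
      ∑ L ∈ 𝓛, |moebiusAPSum (t' L) L (a' L)| := by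
    rw [h𝓛def, sum_image (fun d₁ _ d₂ _ hd => Nat.eq_of_mul_eq_mul_left hk hd)]
    refine sum_congr rfl fun d hd => ?_
    have hkd : k * d / k = d := Nat.mul_div_cancel_left d hk
    have hmem : k * d ∈ 𝓛 := mem_image_of_mem _ hd
    simp only [ht'def, ha'def, hkd]
    rw [if_pos hmem]
  rw [hsum]
  calc ∑ L ∈ 𝓛, |moebiusAPSum (t' L) L (a' L)|
      ≤ ∑ L ∈ Icc 1 Q, |moebiusAPSum (t' L) L (a' L)| :=
        sum_le_sum_of_subset_of_nonneg h𝓛 fun _ _ _ => abs_nonneg _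
    _ ≤ C * x / Real.log x ^ A := by
        refine h x hx₀ Q hQ t' (fun L => ht _) a' fun L _ => ?_
        by_cases hL : L ∈ 𝓛
        · obtain ⟨d, hd, rfl⟩ := mem_image.1 hL
          have hkd : k * d / k = d := Nat.mul_div_cancel_left d hk
          simp only [ha'def, if_pos hL, hkd]
          exact (ZMod.isUnit_iff_coprime _ _).2 (ha d hd)
        · simp only [ha'def, if_neg hL]
          exact isUnit_one

/-- **Regime (1a) of (F′), unconditional** (from the base Bombieri–Vinogradov theorem).  For the
family `r₀ = 1` or `r₀ = 2`, `2 ∣ a`, with `a` prime to every modulus prime to `r₀`, and every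
`A > 0` there are `B > 0`, `C ≥ 0`, `X₀` with: for `X ≥ X₀`, all `lo`, `hi ≤ X`, `y`, `z`, `K` with
`K (2z (log X)^B)² ≤ hi`, `K X^{1/2} ≤ hi`,
`∑_{q ≤ z} |∑_{k ≤ K} 𝟙[(k,r₀)=1] innerP(q,k)| ≤ C X (log X)^{-A}`. -/
theorem sum_abs_innerP_small_le_base (j : ℕ) {r₀ : ℕ} {a : ℤ}
    (hfam : r₀ = 1 ∨ (r₀ = 2 ∧ (2 : ℤ) ∣ a)) (ha : ∀ q : ℕ, q.Coprime r₀ → IsCoprime (q : ℤ) a)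
    (A : ℝ) (hA : 0 < A) :
    ∃ B C X₀ : ℝ, 0 < B ∧ 0 ≤ C ∧ ∀ X : ℝ, X₀ ≤ X → ∀ lo hi y z K : ℕ, (hi : ℝ) ≤ X →
      (K : ℝ) * (2 * z * Real.log X ^ B) ^ 2 ≤ hi → (K : ℝ) * X ^ (1 / 2 : ℝ) ≤ hi →
      ∑ q ∈ Icc 1 z, |∑ k ∈ Icc 1 K,
          (if k.Coprime r₀ then (1 : ℝ) else 0) * innerP j r₀ lo hi y a q k|
        ≤ C * X / Real.log X ^ A :=
  sum_abs_innerP_small_le_of_bv moebiusBVDilate_of_base j hfam ha A hA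

end Summit.Parity.BatemanHorn.Theorems
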